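import Summits.ValiantsHypothesis.ValiantsHypothesis.Theorems.FifoMatchingNNDivisionHardExactIsVirtual
import Literature.Barriers.PneNP.ExtendedFormulationMinkowskiFaces
import HarnessLib

/-!
# PENCIL COLLAPSE — an exact row family with ONE infinitesimal singleton pencil is COR-VIRTUAL
# (crux `NNDivisionHard`, stmt-ValiantsHypothesis-21181; route `FifoMatching`; line `virtual_passenger`; val-idea-41 g5, W7)

Crux workfile (kernel food; elaborates against the TREE: `Theorems/FifoMatchingNNDivisionHardRowFamilies.lean` (the `RowFamily` /
`RowFamily.Law` frame, `T`, `CorVirtualHardN`, `exactTilted`, `ExactPencilLaw`), `Theorems/FifoMatchingNNDivisionHardExactIsVirtual.lean`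
(✓ p688316, val-idea-41 g4: `hCORv`, `law_of_corVirtualHardN` for SHARP families, `exactPencilLaw_iff_corVirtualHardN`) and the Literature EF
calculus `ExtendedFormulationYannakakisConverse` (✓ p687464) / `ExtendedFormulationMinkowskiFaces` / `ExtendedFormulationLinearImage`).

QUESTION LEFT OPEN BY g4 (memo `ExactIsVirtual41.md` §3; critic val-idea-crit-9 g3, CRITIC-wave7 row 140 «L♯(B) candidate untyped (Sharp test
first)»): g4 proved that every SHARP row family (one containing, for every direction `w` and `δ > 0`, a positive multiple of `w` with `δ`-exact
rhs — e.g. the pure-tilt rows `a = ∅` of `exactTilted`) has `F.Law ↔ CorVirtualHardN`, and proposed as the next PROPER intermediate law the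
bounded-tilt exact family **L♯(B)**: rows `(a, W)` with `a ≠ ∅`, `‖W‖∞ ≤ B`, `ρ = udRow a + flat W`, TRULY exact rhs `β = h_COR(ρ)`.  L♯(B) is
NOT sharp (no pure tilts, tilt-to-clique ratio ≤ B).

ANSWER (this file): **L♯(B) collapses too — `(boundedExact B).Law ↔ CorVirtualHardN` for EVERY `B = B(n) > 0`** (`boundedExactLaw_iff`), and so
does the law of the TREE family `exactTilted` restricted to ONE singleton clique with `B`-bounded tilts and its rhs `1 + h_COR(W)`
(`singletonTiltedLaw_iff`; hence `exactPencilLaw_iff_singletonTiltedLaw`: C′ needs neither `a = ∅` nor unbounded tilts to be COR-VIRTUAL).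
The general statement is the

**PENCIL COLLAPSE THEOREM** `law_of_corVirtualHardN_of_pencil`: if a valid row family `F` has, at every large order `k + 1`, an INFINITESIMAL
EXACT PENCIL at the singleton clique `{0}` (`Pencil F (k+1) 0`: for every matrix direction `W` some `ε₀ > 0` such that for all `0 < ε ≤ ε₀` a
positive multiple of the row `udRow {0} + ε • flat W` lies in `F` with exact rhs `β ≤ t · h_COR`), then `CorVirtualHardN → F.Law`
(the converse `F.Law → CorVirtualHardN` is Yannakakis forward, the tree's `corVirtualHardN_of_law`, for every valid family).

MECHANISM (face-local completeness).  Let `G₀ = {x ∈ COR(k+1) : x₀₀ = 1} = conv{x_b : 0 ∈ b}` (an affine copy of `COR(k)`: block coordinates)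
and, for a passenger list `q`, `M₀ = max_j (q_j)₀₀`, `F_Q = conv{q_j : (q_j)₀₀ = M₀}` (the top face of `Q` in direction `E₀₀`).  To first order in
`ε` the pencil row `({0}, εW)` reads EXACTLY the slack of the direction `W` over the face pair `G₀ + F_Q`:
`h_COR(E₀₀ + εW) = 1 + ε · max_{b ∋ 0} ⟨W, x_b⟩` once `ε‖W‖₁ < 1/2` (`hCORv_pencil_le`) and `max_j ⟨E₀₀ + εW, q_j⟩ = M₀ + ε · max_{j top} ⟨W, q_j⟩`
once `ε` is below the vertex gap of `q` in direction `E₀₀` (`passenger_pencil_le`, `exists_small_eps`).  Hence (Hahn–Banach) the pencil rows are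
COMPLETE for `G₀ + F_Q` RELATIVE to the hyperplane `x₀₀ = 1 + M₀` (`pencil_complete`); Yannakakis' converse for a complete family
(`hasEFOfSize_of_complete_nonneg_factorization`, the hyperplane appended as two zero-slack rows) turns an `F`-blind nonnegative factorisation of
the located slack of `COR(k+1) + Q` through slots `σ` into `HasEFOfSize (G₀ + F_Q) |σ|` (`hasEFOfSize_face`); the block projection `π`
(`HasEFOfSize.image_linearMap`, `π(x_{lift b'}) = x_{b'}`) gives `HasEFOfSize (COR(k) + π F_Q) |σ|` (`π_image_face`) while `π F_Q`, a projected
face of `Q`, keeps `Q`'s budget (`hasEFOfSize_topFace`, via `convexHull_inter_dotProduct_eq_of_valid` + `inter_eq` + `image_linearMap`); and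
COR-VIRTUAL at `(c+1, k)` with `T c (k+1) < T (c+1) k` (`T_succ_lt_T_succ`) yields the law's `T c (k+1) < r`.

CONSEQUENCES (memo `PencilCollapse41.md`): (1) g4's design rule «a proper intermediate law must not be sharp» is INSUFFICIENT — the rule of record
becomes «no complete infinitesimal pencil at any singleton clique, at any scale»: proper intermediate located laws have FINITE / DISCRETE tilt
alphabets per order (exact rhs), and such a law is exactly as strong as its alphabet read on the face pair `COR(k) + F_Q`, recursively;
(2) the law-level pencil is the row-side twin of val-idea-43 g6's passenger-side free-face functor `Localization.Face` (✓ p687398 / p688217):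
ONE localisation, seen from the two sides of the slack matrix.

HONEST LABEL: REFORMULATION / law-design result; closes NO route item; `(boundedExact B).Law`, `(singletonTilted B).Law`, `ExactPencilLaw`,
`CorVirtualHardN`, `NNDivisionHard` (21181) all remain OPEN and are here only proved EQUIVALENT; VP ≠ VNP is NOT proved here or anywhere in this tree.
-/

set_option autoImplicit false
set_option linter.dupNamespace false
set_option linter.unusedVariables false

noncomputable section

open Matrix Finset
open scoped Pointwise

namespace Summit.ValiantsHypothesis.ValiantsHypothesis.Cruxes.NNDivisionHard.PencilCollapse41

open Literature.Barriers.PneNP (HasEFOfSize hasEFOfSize_of_complete_nonneg_factorization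
  convexHull_inter_dotProduct_eq_of_valid)
open Literature.Combinatorics.Optimization.FixedSizePsdRank (Cube bvec flat vecOuter corPolytope bvec_zero_or_one)
open Summit.ValiantsHypothesis.ValiantsHypothesis.Theorems.FifoMatching.XcDivision (udInd udPt udRow udMat ud_data)
open Summit.ValiantsHypothesis.ValiantsHypothesis.Theorems.FifoMatching.LocatedRows
  (T CorVirtualHardN RowFamily exactTilted ExactPencilLaw hCOR le_hCOR exists_eq_hCOR flat_le_hCOR unflat flat_unflat
    corVirtualHardN_of_law corVirtualHardN_of_exactPencilLaw)
open Summit.ValiantsHypothesis.ValiantsHypothesis.Theorems.FifoMatching.ExactIsVirtual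
  (hCORv le_hCORv exists_eq_hCORv le_hCORv_of_mem hCOR_eq_hCORv hCORv_smul_le vecOuter_bvec_eq_udPt
    law_of_corVirtualHardN exactTilted_sharp exactPencilLaw_iff_corVirtualHardN)

/-! ## §0 Small helpers -/

section Helpers
variable {n : ℕ}

/-- `flat` is additive (definitional). -/
theorem flat_add₅ (A B : Matrix (Fin n) (Fin n) ℝ) : flat (A + B) = flat A + flat B := rfl

/-- `flat` commutes with scalars (definitional). -/
theorem flat_smul₅ (c : ℝ) (A : Matrix (Fin n) (Fin n) ℝ) : flat (c • A) = c • flat A := rfl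

/-- the singleton clique row is the matrix unit: `udRow {l} = flat (udMat {l})` and `⟨E_ll, x_b⟩ = [l ∈ b]`. -/
theorem udRow_singleton_dotProduct_udPt (l : Fin n) (b : Finset (Fin n)) :
    udRow {l} ⬝ᵥ udPt b = if l ∈ b then 1 else 0 := by
  have h := (ud_data n).2.2.1 {l} b
  by_cases hl : l ∈ b
  · rw [Finset.singleton_inter_of_mem hl, Finset.card_singleton] at h
    rw [if_pos hl]
    norm_num at h
    linarith
  · rw [Finset.singleton_inter_of_notMem hl, Finset.card_empty] at h
    rw [if_neg hl]
    norm_num at h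
    linarith

/-- entries of a clique vertex are `0` or `1`. -/
theorem udPt_apply_zero_or_one (b : Finset (Fin n)) (p : Fin (n * n)) : udPt b p = 0 ∨ udPt b p = 1 := by
  unfold udPt vecOuter udInd
  rcases bvec_zero_or_one (fun i => decide (i ∈ b)) (finProdFinEquiv.symm p).1 with h | h <;>
    rcases bvec_zero_or_one (fun i => decide (i ∈ b)) (finProdFinEquiv.symm p).2 with h' | h' <;>
      · rw [h, h']; norm_num

/-- the `ℓ¹` norm of a direction. -/
def l1 (w : Fin n → ℝ) : ℝ := ∑ p, |w p|

theorem l1_nonneg (w : Fin n → ℝ) : 0 ≤ l1 w := Finset.sum_nonneg fun p _ => abs_nonneg _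

/-- `|⟨w, x_b⟩| ≤ ‖w‖₁`. -/
theorem abs_dotProduct_udPt_le {m : ℕ} (w : Fin (m * m) → ℝ) (b : Finset (Fin m)) : |w ⬝ᵥ udPt b| ≤ l1 w := by
  unfold dotProduct l1
  refine (Finset.abs_sum_le_sum_abs _ _).trans (Finset.sum_le_sum fun p _ => ?_)
  rw [abs_mul]
  rcases udPt_apply_zero_or_one b p with h | h <;> simp [h]

/-- reindex a nonempty finite family by `Fin (K + 1)` (verbatim `LowDim.exists_fin_range_eq`, restated to keep the imports light). -/
theorem exists_fin_range_eq₅ {α J : Type} [Fintype J] [Nonempty J] (q : J → α) :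
    ∃ (K : ℕ) (q' : Fin (K + 1) → α), Set.range q' = Set.range q := by
  obtain ⟨K, hK⟩ := Nat.exists_eq_succ_of_ne_zero (Fintype.card_ne_zero (α := J))
  let e : J ≃ Fin (K + 1) := (Fintype.equivFin J).trans (finCongr hK)
  exact ⟨K, q ∘ e.symm, e.symm.surjective.range_comp q⟩

/-- A SMALL PARAMETER below finitely many thresholds: given `ε₀ > 0`, `L`, `Dv`, and finitely many values `θv i ≤ M`, some
`0 < ε ≤ ε₀` has `ε L < 1/2` and `θv i + ε Dv < M - ε Dv` for every NON-top index (`θv i ≠ M`). -/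
theorem exists_small_eps {ε₀ L Dv M : ℝ} (hε₀ : 0 < ε₀) {ι : Type} [Finite ι] (θv : ι → ℝ) (hθ : ∀ i, θv i ≤ M) :
    ∃ ε : ℝ, 0 < ε ∧ ε ≤ ε₀ ∧ ε * L < 1 / 2 ∧ ∀ i, θv i ≠ M → θv i + ε * Dv < M - ε * Dv := by
  have key : ∀ᶠ ε in nhds (0 : ℝ), ε * L < 1 / 2 ∧ ∀ i, θv i ≠ M → θv i + ε * Dv < M - ε * Dv := by
    refine Filter.Eventually.and ?_ ?_
    · have hc : ContinuousAt (fun ε : ℝ => ε * L) 0 := by fun_prop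
      have hc' : ContinuousAt (fun _ : ℝ => (1 : ℝ) / 2) 0 := continuousAt_const
      exact hc.eventually_lt hc' (by norm_num)
    · refine Filter.eventually_all.2 fun i => ?_
      by_cases hi : θv i = M
      · exact Filter.Eventually.of_forall fun ε h => absurd hi h
      · have hlt : θv i < M := lt_of_le_of_ne (hθ i) hi
        have hc1 : ContinuousAt (fun ε : ℝ => θv i + ε * Dv) 0 := by fun_prop
        have hc2 : ContinuousAt (fun ε : ℝ => M - ε * Dv) 0 := by fun_prop
        have h := hc1.eventually_lt hc2 (by simpa using hlt)
        exact h.mono fun ε h _ => h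
  obtain ⟨δ, hδ, hball⟩ := Metric.eventually_nhds_iff.1 key
  have hpos : 0 < min (δ / 2) ε₀ := lt_min (by linarith) hε₀
  refine ⟨min (δ / 2) ε₀, hpos, min_le_right _ _, ?_⟩
  have hmem : dist (min (δ / 2) ε₀) 0 < δ := by
    rw [Real.dist_eq, sub_zero, abs_of_pos hpos]
    exact lt_of_le_of_lt (min_le_left _ _) (by linarith)
  exact hball hmem

end Helpers

/-! ## §1 The infinitesimal exact pencil -/

/-- **`Pencil F n l`** — the row family `F` contains, at order `n`, an INFINITESIMAL EXACT PENCIL at the singleton clique `l`: for every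
matrix direction `W` and every `δ > 0` some row of `F` is a positive multiple `t • (udRow {l} + ε • flat W)` of the tilted singleton row at
some scale `0 < ε ≤ δ` (scales ACCUMULATING at `0`, direction by direction — no uniformity in `W` is asked), with EXACT right-hand side
(`β ≤ t · h_COR(udRow {l} + ε • flat W)`; `≥` is validity).  Every sharp family has it around each singleton; so does L♯(B)
(`boundedExact_pencil`) and the singleton sub-pencil of `exactTilted` (`singletonTilted_pencil`).  A family with finitely many tilt
SCALES per order and direction (a finite / discrete exact alphabet) does not. -/
def Pencil (F : RowFamily) (n : ℕ) (l : Fin n) : Prop :=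
  ∀ W : Matrix (Fin n) (Fin n) ℝ, ∀ δ : ℝ, 0 < δ → ∃ ε : ℝ, 0 < ε ∧ ε ≤ δ ∧
    ∃ a : F.A n, ∃ t : ℝ, 0 < t ∧ F.ρ n a = t • (udRow {l} + ε • flat W) ∧
      F.β n a ≤ t * hCORv (udRow {l} + ε • flat W)

/-! ## §2 The face `x₀₀ = 1` of `COR(k+1)` and the first-order (face-local) reading of a pencil row -/

section Face
variable {k : ℕ}

/-- lift `b' ⊆ [k]` to the vertex index `{0} ∪ succ(b')` of the face `x₀₀ = 1`. -/
def lift (b' : Finset (Fin k)) : Finset (Fin (k + 1)) := insert 0 (b'.map (Fin.succEmb k))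

theorem zero_mem_lift (b' : Finset (Fin k)) : (0 : Fin (k + 1)) ∈ lift b' := Finset.mem_insert_self _ _

theorem succ_mem_lift {b' : Finset (Fin k)} {i : Fin k} : i.succ ∈ lift b' ↔ i ∈ b' := by
  rw [lift, Finset.mem_insert]
  constructor
  · rintro (h | h)
    · exact absurd h (Fin.succ_ne_zero i)
    · obtain ⟨a, ha, hai⟩ := Finset.mem_map.1 h
      have : a = i := Fin.succ_injective _ (by simpa using hai)
      exact this ▸ ha
  · intro h
    exact Or.inr (Finset.mem_map.2 ⟨i, h, by simp⟩)

/-- the block part of a vertex index. -/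
def down (b : Finset (Fin (k + 1))) : Finset (Fin k) := Finset.univ.filter fun i => i.succ ∈ b

/-- a vertex index containing `0` is the lift of its block part. -/
theorem lift_down {b : Finset (Fin (k + 1))} (h0 : (0 : Fin (k + 1)) ∈ b) : lift (down b) = b := by
  ext i
  refine Fin.cases ?_ (fun i' => ?_) i
  · exact iff_of_true (zero_mem_lift _) h0
  · rw [succ_mem_lift]
    simp [down]

/-- the face maximum `max_{b ∋ 0} ⟨w, x_b⟩`, indexed through `lift`. -/
def ΦC (w : Fin ((k + 1) * (k + 1)) → ℝ) : ℝ :=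
  Finset.univ.sup' Finset.univ_nonempty (fun b' : Finset (Fin k) => w ⬝ᵥ udPt (lift b'))

/-- ★ FIRST-ORDER READING, COR SIDE: `h_COR(E₀₀ + ε w) ≤ 1 + ε · max_{b ∋ 0} ⟨w, x_b⟩` once `ε ‖w‖₁ < 1/2` (the maximum localises to the
face `x₀₀ = 1`; equality in fact). -/
theorem hCORv_pencil_le (w : Fin ((k + 1) * (k + 1)) → ℝ) {ε : ℝ} (hε : 0 < ε) (hεw : ε * l1 w < 1 / 2) :
    hCORv (udRow {0} + ε • w) ≤ 1 + ε * ΦC w := by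
  refine Finset.sup'_le _ _ fun b _ => ?_
  rw [add_dotProduct, smul_dotProduct, smul_eq_mul, udRow_singleton_dotProduct_udPt]
  have hwb : |w ⬝ᵥ udPt b| ≤ l1 w := abs_dotProduct_udPt_le w b
  have h1 : w ⬝ᵥ udPt (lift (down b)) ≤ ΦC w :=
    Finset.le_sup' (fun b' : Finset (Fin k) => w ⬝ᵥ udPt (lift b')) (Finset.mem_univ (down b))
  by_cases h0 : (0 : Fin (k + 1)) ∈ b
  · rw [if_pos h0]
    rw [lift_down h0] at h1
    have h2 := mul_le_mul_of_nonneg_left h1 hε.le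
    linarith
  · rw [if_neg h0]
    have h2 : |w ⬝ᵥ udPt (lift (down b))| ≤ l1 w := abs_dotProduct_udPt_le w _
    have ha := (abs_le.1 hwb).2
    have hb := (abs_le.1 h2).1
    have e1 := mul_le_mul_of_nonneg_left ha hε.le
    have e2 := mul_le_mul_of_nonneg_left hb hε.le
    have e3 := mul_le_mul_of_nonneg_left h1 hε.le
    have e4 : ε * -l1 w = -(ε * l1 w) := by ring
    linarith

variable {K : ℕ}

/-- the `(0,0)` entries of the passenger generators, `θ_j = ⟨E₀₀, q_j⟩`. -/
def θ (q : Fin (K + 1) → (Fin ((k + 1) * (k + 1)) → ℝ)) (j : Fin (K + 1)) : ℝ := udRow {0} ⬝ᵥ q j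

/-- their maximum `M₀`. -/
def M₀ (q : Fin (K + 1) → (Fin ((k + 1) * (k + 1)) → ℝ)) : ℝ := Finset.univ.sup' Finset.univ_nonempty (θ q)

/-- the TOP index set of the passenger in direction `E₀₀`. -/
def top (q : Fin (K + 1) → (Fin ((k + 1) * (k + 1)) → ℝ)) : Finset (Fin (K + 1)) :=
  Finset.univ.filter fun j => θ q j = M₀ q

theorem θ_le_M₀ (q : Fin (K + 1) → (Fin ((k + 1) * (k + 1)) → ℝ)) (j : Fin (K + 1)) : θ q j ≤ M₀ q :=
  Finset.le_sup' (θ q) (Finset.mem_univ j)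

theorem top_nonempty (q : Fin (K + 1) → (Fin ((k + 1) * (k + 1)) → ℝ)) : (top q).Nonempty := by
  obtain ⟨j, -, hj⟩ := Finset.exists_mem_eq_sup' Finset.univ_nonempty (θ q)
  refine ⟨j, Finset.mem_filter.2 ⟨Finset.mem_univ _, ?_⟩⟩
  unfold M₀
  exact hj.symm

theorem mem_top {q : Fin (K + 1) → (Fin ((k + 1) * (k + 1)) → ℝ)} {j : Fin (K + 1)} : j ∈ top q ↔ θ q j = M₀ q := by
  simp [top]

/-- the face maximum `max_{j top} ⟨w, q_j⟩` of the passenger. -/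
def ΦQ (q : Fin (K + 1) → (Fin ((k + 1) * (k + 1)) → ℝ)) (w : Fin ((k + 1) * (k + 1)) → ℝ) : ℝ :=
  (top q).sup' (top_nonempty q) fun j => w ⬝ᵥ q j

/-- a bound `D ≥ |⟨w, q_j⟩|` for all `j`. -/
def D (q : Fin (K + 1) → (Fin ((k + 1) * (k + 1)) → ℝ)) (w : Fin ((k + 1) * (k + 1)) → ℝ) : ℝ :=
  Finset.univ.sup' Finset.univ_nonempty fun j : Fin (K + 1) => |w ⬝ᵥ q j|

theorem D_nonneg (q : Fin (K + 1) → (Fin ((k + 1) * (k + 1)) → ℝ)) (w : Fin ((k + 1) * (k + 1)) → ℝ) : 0 ≤ D q w :=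
  (abs_nonneg (w ⬝ᵥ q 0)).trans (Finset.le_sup' (fun j => |w ⬝ᵥ q j|) (Finset.mem_univ 0))

/-- ★ FIRST-ORDER READING, PASSENGER SIDE: below the vertex gap, `⟨E₀₀ + ε w, q_j⟩ ≤ M₀ + ε · max_{j top} ⟨w, q_j⟩` for every `j`. -/
theorem passenger_pencil_le (q : Fin (K + 1) → (Fin ((k + 1) * (k + 1)) → ℝ)) (w : Fin ((k + 1) * (k + 1)) → ℝ)
    {ε : ℝ} (hε : 0 < ε) (hgap : ∀ j, θ q j ≠ M₀ q → θ q j + ε * D q w < M₀ q - ε * D q w) (j : Fin (K + 1)) :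
    (udRow {0} + ε • w) ⬝ᵥ q j ≤ M₀ q + ε * ΦQ q w := by
  rw [add_dotProduct, smul_dotProduct, smul_eq_mul]
  change θ q j + ε * (w ⬝ᵥ q j) ≤ _
  obtain ⟨j₀, hj₀⟩ := top_nonempty q
  have hj₀' : w ⬝ᵥ q j₀ ≤ ΦQ q w := Finset.le_sup' (fun j => w ⬝ᵥ q j) hj₀
  have hD0 : |w ⬝ᵥ q j₀| ≤ D q w := Finset.le_sup' (fun j => |w ⬝ᵥ q j|) (Finset.mem_univ j₀)
  have hDj : |w ⬝ᵥ q j| ≤ D q w := Finset.le_sup' (fun j => |w ⬝ᵥ q j|) (Finset.mem_univ j)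
  by_cases hj : θ q j = M₀ q
  · have hjt : w ⬝ᵥ q j ≤ ΦQ q w := Finset.le_sup' (fun j => w ⬝ᵥ q j) (mem_top.2 hj)
    rw [hj]
    have := mul_le_mul_of_nonneg_left hjt hε.le
    linarith
  · have h := hgap j hj
    have h1 := (abs_le.1 hDj).2
    have h2 := (abs_le.1 hD0).1
    have e1 := mul_le_mul_of_nonneg_left h1 hε.le
    have e2 := mul_le_mul_of_nonneg_left h2 hε.le
    have e3 := mul_le_mul_of_nonneg_left hj₀' hε.le
    have e4 : ε * -D q w = -(ε * D q w) := by ring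
    linarith

/-! ## §3 Relative completeness of the pencil for the face pair (Hahn–Banach) -/

/-- the LOCATED COLUMNS of the face pair: `(b', j) ↦ x_{lift b'} + q_j`, `j` a top index; their hull is
`G₀ + F_Q = conv{x_b : 0 ∈ b} + conv{q_j : j top}`. -/
def faceVert (q : Fin (K + 1) → (Fin ((k + 1) * (k + 1)) → ℝ)) :
    Finset (Fin k) × (top q) → (Fin ((k + 1) * (k + 1)) → ℝ) :=
  fun p => udPt (lift p.1) + q (p.2 : Fin (K + 1))

/-- ★★ **RELATIVE COMPLETENESS OF THE PENCIL.**  A point ON the hyperplane `x₀₀ = 1 + M₀` that satisfies every row inequality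
`ρ_a · x ≤ β_a + m_a` of a family with an infinitesimal exact pencil at `{0}` (passenger maxima `m_a` attained) lies in the face pair
`conv{x_{lift b'} + q_j}`.  (Separate a bad point by `w`; the pencil row `({0}, εw)` for small `ε` reads `w` on the face pair and is violated.) -/
theorem pencil_complete (F : RowFamily) (hP : Pencil F (k + 1) 0) (q : Fin (K + 1) → (Fin ((k + 1) * (k + 1)) → ℝ))
    (m : F.A (k + 1) → ℝ) (hmax : ∀ a, ∃ j, F.ρ (k + 1) a ⬝ᵥ q j = m a)
    (x : Fin ((k + 1) * (k + 1)) → ℝ) (hx : udRow {0} ⬝ᵥ x = 1 + M₀ q)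
    (hrow : ∀ a : F.A (k + 1), F.ρ (k + 1) a ⬝ᵥ x ≤ F.β (k + 1) a + m a) :
    x ∈ convexHull ℝ (Set.range (faceVert q)) := by
  classical
  by_contra hxP
  have hcl : IsClosed (convexHull ℝ (Set.range (faceVert q))) :=
    (Set.Finite.isCompact_convexHull (𝕜 := ℝ) (Set.finite_range _)).isClosed
  obtain ⟨f, u, hfP, hux⟩ := geometric_hahn_banach_closed_point (convex_convexHull ℝ _) hcl hxP
  -- the functional as a vector
  let w : Fin ((k + 1) * (k + 1)) → ℝ := fun p => f (Pi.single p 1)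
  have hfw : ∀ z : Fin ((k + 1) * (k + 1)) → ℝ, f z = w ⬝ᵥ z := by
    intro z
    conv_lhs => rw [pi_eq_sum_univ' z]
    rw [map_sum]
    simp only [map_smul, smul_eq_mul, dotProduct, w]
    refine Finset.sum_congr rfl fun p _ => ?_
    ring
  -- the two maximisers on the face pair, and `ΦC + ΦQ < u < w · x`
  obtain ⟨b₀, -, hb₀⟩ :=
    Finset.exists_mem_eq_sup' Finset.univ_nonempty (fun b' : Finset (Fin k) => w ⬝ᵥ udPt (lift b'))
  obtain ⟨j₀, hj₀, hj₀'⟩ := Finset.exists_mem_eq_sup' (top_nonempty q) (fun j => w ⬝ᵥ q j)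
  have hlt : ΦC w + ΦQ q w < u := by
    have h := hfP (faceVert q (b₀, ⟨j₀, hj₀⟩)) (subset_convexHull ℝ _ ⟨(b₀, ⟨j₀, hj₀⟩), rfl⟩)
    rw [hfw] at h
    simp only [faceVert, dotProduct_add] at h
    unfold ΦC ΦQ
    rw [hb₀, hj₀']
    exact h
  have hux' : u < w ⬝ᵥ x := by rwa [hfw] at hux
  -- a pencil row below all thresholds (the thresholds are monotone in the scale)
  obtain ⟨δ, hδ, -, hδL, hδgap⟩ :=
    exists_small_eps (L := l1 w) (Dv := D q w) one_pos (θ q) (θ_le_M₀ q)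
  obtain ⟨ε, hε, hεδ, a, t, ht, hρ, hβ⟩ := hP (unflat w) δ hδ
  have hεL : ε * l1 w < 1 / 2 := lt_of_le_of_lt (mul_le_mul_of_nonneg_right hεδ (l1_nonneg w)) hδL
  have hgap : ∀ j, θ q j ≠ M₀ q → θ q j + ε * D q w < M₀ q - ε * D q w := fun j hj => by
    have h := hδgap j hj
    have e := mul_le_mul_of_nonneg_right hεδ (D_nonneg q w)
    linarith
  rw [flat_unflat] at hρ hβ
  have hC := hCORv_pencil_le w hε hεL
  obtain ⟨j₁, hj₁⟩ := hmax a
  have hQ := passenger_pencil_le q w hε hgap j₁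
  have h1 := hrow a
  rw [hρ, smul_dotProduct, smul_eq_mul] at h1 hj₁
  have hxval : (udRow {0} + ε • w) ⬝ᵥ x = 1 + M₀ q + ε * (w ⬝ᵥ x) := by
    rw [add_dotProduct, smul_dotProduct, smul_eq_mul, hx]
  rw [hxval] at h1
  have p1 := mul_le_mul_of_nonneg_left hC ht.le
  have p2 := mul_le_mul_of_nonneg_left hQ ht.le
  -- `t (1 + M₀ + ε w·x) ≤ t (1 + ε ΦC) + t (M₀ + ε ΦQ)`
  have key : t * (1 + M₀ q + ε * (w ⬝ᵥ x)) ≤ t * (1 + ε * ΦC w) + t * (M₀ q + ε * ΦQ q w) := by linarith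
  have key1 : t * (1 + M₀ q + ε * (w ⬝ᵥ x)) ≤ t * ((1 + ε * ΦC w) + (M₀ q + ε * ΦQ q w)) := by
    have e := mul_add t (1 + ε * ΦC w) (M₀ q + ε * ΦQ q w)
    linarith
  have key2 : 1 + M₀ q + ε * (w ⬝ᵥ x) ≤ (1 + ε * ΦC w) + (M₀ q + ε * ΦQ q w) := le_of_mul_le_mul_left key1 ht
  have key3 : ε * (w ⬝ᵥ x) ≤ ε * ΦC w + ε * ΦQ q w := by linarith
  have key4 : w ⬝ᵥ x ≤ ΦC w + ΦQ q w := by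
    rw [← mul_add] at key3
    exact le_of_mul_le_mul_left key3 hε
  linarith

/-! ## §4 Yannakakis' converse on the face pair -/

/-- ★★ **THE FACE PAIR HAS A SMALL EF.**  If the located slack of `COR(k+1) + Q` against a family with an infinitesimal exact pencil at `{0}`
factors nonnegatively through slots `σ` (a BLIND factorisation), then `xc(G₀ + F_Q) ≤ |σ|`: the pencil is complete for the face pair relative
to `x₀₀ = 1 + M₀` (§3), the hyperplane is appended as two zero-slack rows, and `hasEFOfSize_of_complete_nonneg_factorization` applies to the
located columns. -/
theorem hasEFOfSize_face (F : RowFamily) (hP : Pencil F (k + 1) 0) (q : Fin (K + 1) → (Fin ((k + 1) * (k + 1)) → ℝ))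
    (m : F.A (k + 1) → ℝ) (hmax : ∀ a, ∃ j, F.ρ (k + 1) a ⬝ᵥ q j = m a) {σ : Type} [Fintype σ]
    (U : F.A (k + 1) → σ → ℝ) (V : Finset (Fin (k + 1)) × Fin (K + 1) → σ → ℝ)
    (hU : ∀ a i, 0 ≤ U a i) (hV : ∀ p i, 0 ≤ V p i)
    (hfac : ∀ a b j, (F.β (k + 1) a + m a) - F.ρ (k + 1) a ⬝ᵥ (udPt b + q j) = ∑ i, U a i * V (b, j) i) :
    HasEFOfSize (convexHull ℝ (Set.range (faceVert q))) (Fintype.card σ) := by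
  classical
  refine hasEFOfSize_of_complete_nonneg_factorization (A := F.A (k + 1) ⊕ Bool) (faceVert q)
    (Sum.elim (F.ρ (k + 1)) (fun s => if s then udRow {0} else -udRow {0}))
    (Sum.elim (fun a => F.β (k + 1) a + m a) (fun s => if s then 1 + M₀ q else -(1 + M₀ q)))
    ?_ (Sum.elim U (fun _ _ => 0)) (fun p => V (lift p.1, (p.2 : Fin (K + 1)))) ?_ (fun p i => hV _ i) ?_
  · intro x hx
    have h1 := hx (Sum.inr true)
    have h2 := hx (Sum.inr false)
    simp only [Sum.elim_inr] at h1 h2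
    simp at h1 h2
    refine pencil_complete F hP q m hmax x (by linarith) fun a => ?_
    exact hx (Sum.inl a)
  · rintro (a | s) i
    · exact hU a i
    · simp
  · rintro (a | s) ⟨b', j⟩
    · exact hfac a (lift b') (j : Fin (K + 1))
    · have hq : udRow {0} ⬝ᵥ q (j : Fin (K + 1)) = M₀ q := mem_top.1 j.2
      have hb : udRow {0} ⬝ᵥ udPt (lift b') = 1 := by
        rw [udRow_singleton_dotProduct_udPt, if_pos (zero_mem_lift b')]
      cases s <;> (simp [faceVert, dotProduct_add, neg_dotProduct, hq, hb]; try ring)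

/-! ## §5 Transport to `COR(k) + Q'` by the block projection -/

/-- block coordinates `(i', j') ↦ (succ i', succ j')`. -/
def emb (p : Fin (k * k)) : Fin ((k + 1) * (k + 1)) :=
  finProdFinEquiv (Fin.succ (finProdFinEquiv.symm p).1, Fin.succ (finProdFinEquiv.symm p).2)

/-- the block projection `π x = x ∘ emb : ℝ^{(k+1)²} → ℝ^{k²}`. -/
def π : (Fin ((k + 1) * (k + 1)) → ℝ) →ₗ[ℝ] (Fin (k * k) → ℝ) := LinearMap.funLeft ℝ ℝ emb

theorem π_apply (x : Fin ((k + 1) * (k + 1)) → ℝ) (p : Fin (k * k)) : π x p = x (emb p) := rfl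

/-- ★ the face vertex `x_{lift b'}` projects to the vertex `x_{b'}` of `COR(k)`. -/
theorem π_udPt_lift (b' : Finset (Fin k)) : π (udPt (lift b')) = udPt b' := by
  funext p
  rw [π_apply]
  simp only [udPt, vecOuter, emb, Equiv.symm_apply_apply, udInd, bvec, succ_mem_lift]

theorem π_faceVert (q : Fin (K + 1) → (Fin ((k + 1) * (k + 1)) → ℝ)) (p : Finset (Fin k) × (top q)) :
    π (faceVert q p) = udPt p.1 + π (q (p.2 : Fin (K + 1))) := by
  simp only [faceVert, map_add, π_udPt_lift]

/-- `COR(k)` is the hull of the clique vertices indexed by subsets. -/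
theorem corPolytope_eq_convexHull_udPt : corPolytope k = convexHull ℝ (Set.range (udPt : Finset (Fin k) → _)) := by
  unfold corPolytope
  congr 1
  ext y
  constructor
  · rintro ⟨a, rfl⟩
    exact ⟨Finset.univ.filter fun i => a i = true, (vecOuter_bvec_eq_udPt a).symm⟩
  · rintro ⟨b, rfl⟩
    exact ⟨fun i => decide (i ∈ b), rfl⟩

/-- ★ the block projection of the face pair is `COR(k) + conv(projected top generators)`. -/
theorem π_image_face (q : Fin (K + 1) → (Fin ((k + 1) * (k + 1)) → ℝ)) :
    π '' convexHull ℝ (Set.range (faceVert q)) =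
      corPolytope k + convexHull ℝ (Set.range fun j : top q => π (q (j : Fin (K + 1)))) := by
  rw [LinearMap.image_convexHull, ← Set.range_comp]
  have hr : Set.range (π ∘ faceVert q) =
      Set.range (udPt : Finset (Fin k) → _) + Set.range (fun j : top q => π (q (j : Fin (K + 1)))) := by
    ext y
    simp only [Set.mem_range, Set.mem_add, Function.comp_apply, π_faceVert]
    constructor
    · rintro ⟨⟨b', j⟩, rfl⟩
      exact ⟨_, ⟨b', rfl⟩, _, ⟨j, rfl⟩, rfl⟩
    · rintro ⟨_, ⟨b', rfl⟩, _, ⟨j, rfl⟩, rfl⟩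
      exact ⟨⟨b', j⟩, rfl⟩
  rw [hr, convexHull_add, corPolytope_eq_convexHull_udPt]

/-- ★ the projected top face of the passenger keeps the passenger's budget: `xc(π F_Q) ≤ xc(Q)` (a face, then a linear image). -/
theorem hasEFOfSize_topFace (q : Fin (K + 1) → (Fin ((k + 1) * (k + 1)) → ℝ)) {r : ℕ}
    (hQ : HasEFOfSize (convexHull ℝ (Set.range q)) r) :
    HasEFOfSize (convexHull ℝ (Set.range fun j : top q => π (q (j : Fin (K + 1))))) r := by
  classical
  have hval : ∀ s ∈ (Finset.univ.image q), udRow {0} ⬝ᵥ s ≤ M₀ q := by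
    intro s hs
    obtain ⟨j, -, rfl⟩ := Finset.mem_image.1 hs
    exact θ_le_M₀ q j
  have hface := convexHull_inter_dotProduct_eq_of_valid (Finset.univ.image q) (udRow {0}) (M₀ q) hval
  have h1 : HasEFOfSize (convexHull ℝ (Set.range q) ∩ {y | udRow {0} ⬝ᵥ y = M₀ q}) r := hQ.inter_eq _ _
  have hrange : Set.range q = ((Finset.univ.image q : Finset (Fin ((k + 1) * (k + 1)) → ℝ)) : Set _) := by
    simp [Finset.coe_image]
  rw [hrange, hface] at h1
  have h2 := h1.image_linearMap π
  rw [LinearMap.image_convexHull] at h2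
  have hset : (π : (Fin ((k + 1) * (k + 1)) → ℝ) →ₗ[ℝ] (Fin (k * k) → ℝ)) ''
      (((Finset.univ.image q).filter fun s => udRow {0} ⬝ᵥ s = M₀ q : Finset _) : Set _) =
      Set.range (fun j : top q => π (q (j : Fin (K + 1)))) := by
    ext y
    constructor
    · rintro ⟨s, hs, rfl⟩
      rw [Finset.mem_coe, Finset.mem_filter] at hs
      obtain ⟨hs1, hs2⟩ := hs
      obtain ⟨j, -, rfl⟩ := Finset.mem_image.1 hs1
      exact ⟨⟨j, mem_top.2 hs2⟩, rfl⟩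
    · rintro ⟨j, rfl⟩
      refine ⟨q (j : Fin (K + 1)), ?_, rfl⟩
      rw [Finset.mem_coe, Finset.mem_filter]
      exact ⟨Finset.mem_image.2 ⟨(j : Fin (K + 1)), Finset.mem_univ _, rfl⟩, mem_top.1 j.2⟩
  rw [hset] at h2
  exact h2

/-- POINTWISE (species) form: at order `k + 1`, a factorisation of the located slack of `COR(k+1) + Q` through slots `σ` that is BLIND to a
family with an infinitesimal exact pencil at `{0}` yields `HasEFOfSize (COR(k) + Q') |σ|` for the projected top face `Q'` of `Q`
(whose own budget is at most that of `Q`, `hasEFOfSize_topFace`). -/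
theorem hasEFOfSize_corFace_of_pencil_blind (F : RowFamily) (hP : Pencil F (k + 1) 0)
    (q : Fin (K + 1) → (Fin ((k + 1) * (k + 1)) → ℝ))
    (m : F.A (k + 1) → ℝ) (hmax : ∀ a, ∃ j, F.ρ (k + 1) a ⬝ᵥ q j = m a) {σ : Type} [Fintype σ]
    (U : F.A (k + 1) → σ → ℝ) (V : Finset (Fin (k + 1)) × Fin (K + 1) → σ → ℝ)
    (hU : ∀ a i, 0 ≤ U a i) (hV : ∀ p i, 0 ≤ V p i)
    (hfac : ∀ a b j, (F.β (k + 1) a + m a) - F.ρ (k + 1) a ⬝ᵥ (udPt b + q j) = ∑ i, U a i * V (b, j) i) :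
    HasEFOfSize (corPolytope k + convexHull ℝ (Set.range fun j : top q => π (q (j : Fin (K + 1))))) (Fintype.card σ) := by
  have h := (hasEFOfSize_face F hP q m hmax U V hU hV hfac).image_linearMap π
  rwa [π_image_face] at h

end Face

/-! ## §6 The pencil collapse theorem -/

/-- budget bookkeeping across the order shift: `T c (k+1) < T (c+1) k` once `k ≥ 2`. -/
theorem T_succ_lt_T_succ {c k : ℕ} (hk : 2 ≤ k) : T c (k + 1) < T (c + 1) k := by
  unfold T
  have hL : 1 ≤ Nat.log 2 k := Nat.log_pos (by norm_num) hk
  have hlog : Nat.log 2 (k + 1) ≤ Nat.log 2 k + 1 := by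
    have h1 : k + 1 ≤ k * 2 := by omega
    calc Nat.log 2 (k + 1) ≤ Nat.log 2 (k * 2) := Nat.log_mono_right h1
      _ = Nat.log 2 k + 1 := Nat.log_mul_base (by norm_num) (by omega)
  set L := Nat.log 2 k with hLdef
  set L' := Nat.log 2 (k + 1) with hL'def
  refine Nat.pow_lt_pow_right (by norm_num) ?_
  have h1 : (L' + c) ^ c ≤ (L + c + 1) ^ c := Nat.pow_le_pow_left (by omega) c
  have h2 : 1 ≤ (L + c + 1) ^ c := Nat.one_le_pow c (L + c + 1) (by omega)
  have h3 : L + (c + 1) = L + c + 1 := by omega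
  rw [h3, pow_succ]
  calc (L' + c) ^ c ≤ (L + c + 1) ^ c := h1
    _ < (L + c + 1) ^ c * 2 := by omega
    _ ≤ (L + c + 1) ^ c * (L + c + 1) := Nat.mul_le_mul_left _ (by omega)

/-- ★★★ **PENCIL COLLAPSE.**  A valid row family with an infinitesimal exact pencil at the singleton clique `{0}` at every large order has
its located law implied by COR-VIRTUAL: `CorVirtualHardN → F.Law`.  (With the tree's `corVirtualHardN_of_law`: `F.Law ↔ CorVirtualHardN`.) -/
theorem law_of_corVirtualHardN_of_pencil (F : RowFamily) (k₁ : ℕ) (hP : ∀ k, k₁ ≤ k → Pencil F (k + 1) 0)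
    (hV : CorVirtualHardN) : F.Law := by
  classical
  intro c
  obtain ⟨n₀, hn₀⟩ := hV (c + 1)
  refine ⟨n₀ + k₁ + 3, fun n hn K q r hQ m hmq hmax U V hU hV' hfac => ?_⟩
  obtain ⟨k, rfl⟩ : ∃ k, n = k + 1 := ⟨n - 1, by omega⟩
  have hk₀ : n₀ ≤ k := by omega
  have hk₁ : k₁ ≤ k := by omega
  have hk2 : 2 ≤ k := by omega
  have himg := hasEFOfSize_corFace_of_pencil_blind F (hP k hk₁) q m hmax U V hU hV' hfac
  rw [Fintype.card_option, Fintype.card_fin] at himg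
  haveI : Nonempty (top q) := (top_nonempty q).coe_sort
  obtain ⟨K', q', hq'⟩ := exists_fin_range_eq₅ (fun j : top q => π (q (j : Fin (K + 1))))
  rw [← hq'] at himg
  have hQ' : HasEFOfSize (convexHull ℝ (Set.range q')) r := by
    rw [hq']
    exact hasEFOfSize_topFace q hQ
  have h1 : T (c + 1) k < r + 1 := hn₀ k hk₀ K' q' (r + 1) himg hQ'.succ
  have h2 : T c (k + 1) < T (c + 1) k := T_succ_lt_T_succ hk2
  omega

/-- … packaged as an equivalence. -/
theorem law_iff_corVirtualHardN_of_pencil (F : RowFamily) (k₁ : ℕ) (hP : ∀ k, k₁ ≤ k → Pencil F (k + 1) 0) :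
    F.Law ↔ CorVirtualHardN :=
  ⟨corVirtualHardN_of_law F, law_of_corVirtualHardN_of_pencil F k₁ hP⟩

/-! ## §7 Instances: L♯(B) and the singleton sub-pencil of `exactTilted` -/

/-- **L♯(B)** (val-idea-41 g4's candidate, `ExactIsVirtual41.md` §3): NONEMPTY clique `a`, tilt `W` with `|W_ij| ≤ B(n)`,
`ρ = udRow a + flat W`, TRULY exact right-hand side `β = h_COR(ρ)`.  Not sharp (no pure tilts; tilt-to-clique ratio `≤ n² B(n)`). -/
@[reducible] def boundedExact (B : ℕ → ℝ) : RowFamily where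
  A := fun n => {p : Finset (Fin n) × Matrix (Fin n) (Fin n) ℝ // p.1.Nonempty ∧ ∀ i j, |p.2 i j| ≤ B n}
  ρ := fun _ a => udRow a.1.1 + flat a.1.2
  β := fun _ a => hCORv (udRow a.1.1 + flat a.1.2)
  valid := fun _ a => le_hCORv_of_mem _

/-- each entry of a matrix is bounded by the `ℓ¹` norm of its flattening. -/
theorem abs_apply_le_l1_flat {n : ℕ} (W : Matrix (Fin n) (Fin n) ℝ) (i j : Fin n) : |W i j| ≤ l1 (flat W) := by
  have h := Finset.single_le_sum (f := fun p : Fin (n * n) => |flat W p|) (fun p _ => abs_nonneg _)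
    (Finset.mem_univ (finProdFinEquiv (i, j)))
  simpa [flat, l1] using h

/-- L♯(B) has the infinitesimal exact pencil at `{0}` (for every `B > 0`): the rows `({0}, εW)`, `ε ≤ B / (‖W‖₁ + 1)`. -/
theorem boundedExact_pencil (B : ℕ → ℝ) (hB : ∀ n, 0 < B n) (k : ℕ) : Pencil (boundedExact B) (k + 1) 0 := by
  intro W δ hδ
  set S : ℝ := l1 (flat W) with hS
  have hS0 : 0 ≤ S := l1_nonneg _
  have hε0 : 0 < B (k + 1) / (S + 1) := div_pos (hB _) (by linarith)
  refine ⟨min δ (B (k + 1) / (S + 1)), lt_min hδ hε0, min_le_left _ _, ?_⟩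
  set ε : ℝ := min δ (B (k + 1) / (S + 1)) with hεdef
  have hε : 0 < ε := lt_min hδ hε0
  have hεle : ε ≤ B (k + 1) / (S + 1) := min_le_right _ _
  have hent : ∀ i j, |(ε • W) i j| ≤ B (k + 1) := by
    intro i j
    rw [Matrix.smul_apply, smul_eq_mul, abs_mul, abs_of_pos hε]
    have hij : |W i j| ≤ S := abs_apply_le_l1_flat W i j
    have h3 : B (k + 1) / (S + 1) * S ≤ B (k + 1) := by
      rw [div_mul_eq_mul_div, div_le_iff₀ (by linarith)]
      nlinarith [hB (k + 1)]
    calc ε * |W i j| ≤ ε * S := mul_le_mul_of_nonneg_left hij hε.le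
      _ ≤ B (k + 1) / (S + 1) * S := mul_le_mul_of_nonneg_right hεle hS0
      _ ≤ B (k + 1) := h3
  refine ⟨⟨(({0} : Finset (Fin (k + 1))), ε • W), ⟨Finset.singleton_nonempty 0, hent⟩⟩, 1, one_pos, ?_, ?_⟩
  · show udRow {0} + flat (ε • W) = (1 : ℝ) • (udRow {0} + ε • flat W)
    rw [one_smul]
    rfl
  · show hCORv (udRow {0} + flat (ε • W)) ≤ 1 * hCORv (udRow {0} + ε • flat W)
    rw [one_mul]
    exact le_rfl

/-- ★★★ **g4's candidate L♯(B) IS COR-VIRTUAL**: `(boundedExact B).Law ↔ CorVirtualHardN` for every `B = B(n) > 0`. -/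
theorem boundedExactLaw_iff (B : ℕ → ℝ) (hB : ∀ n, 0 < B n) : (boundedExact B).Law ↔ CorVirtualHardN :=
  law_iff_corVirtualHardN_of_pencil _ 0 fun k _ => boundedExact_pencil B hB k

/-- … and hence equivalent to the law of record C′. -/
theorem boundedExactLaw_iff_exactPencilLaw (B : ℕ → ℝ) (hB : ∀ n, 0 < B n) : (boundedExact B).Law ↔ ExactPencilLaw :=
  (boundedExactLaw_iff B hB).trans exactPencilLaw_iff_corVirtualHardN.symm

/-- **the singleton sub-pencil of `exactTilted`**: rows `({l}, W)` with `|W_ij| ≤ B(n)` and `exactTilted`'s rhs `1 + h_COR(W)`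
(exact on the half-cone of tilts whose COR-maximum sits in the face `x_ll = 1`, loose elsewhere). -/
@[reducible] def singletonTilted (B : ℕ → ℝ) : RowFamily where
  A := fun n => {p : Fin n × Matrix (Fin n) (Fin n) ℝ // ∀ i j, |p.2 i j| ≤ B n}
  ρ := fun _ a => udRow {a.1.1} + flat a.1.2
  β := fun _ a => 1 + hCOR a.1.2
  valid := fun n a => exactTilted.valid n ({a.1.1}, a.1.2)

/-- it embeds in `exactTilted`. -/
def singletonTiltedEmb (B : ℕ → ℝ) : RowFamily.Emb (singletonTilted B) exactTilted where
  φ := fun _ a => ({a.1.1}, a.1.2)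
  ρ_eq := fun _ _ => rfl
  β_eq := fun _ _ => rfl

/-- entries of the singleton clique matrix are bounded by `1`. -/
theorem abs_udMat_singleton_le {n : ℕ} (l i j : Fin n) : |udMat {l} i j| ≤ 1 := by
  unfold udMat udInd bvec
  by_cases hi : i = l
  · by_cases hj : j = l
    · subst hi; subst hj
      norm_num [Finset.mem_singleton]
    · have hlj : l ≠ j := fun h => hj h.symm
      simp [hi, hlj, hj, Finset.mem_singleton]
  · simp [hi, Finset.mem_singleton]

/-- the tilted row of the singleton sub-pencil in closed form: `⟨flat (μ W + ν E₀₀), x_b⟩ = μ ⟨W, x_b⟩ + ν [0 ∈ b]`. -/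
theorem flat_tilt_dotProduct_udPt {k : ℕ} (W : Matrix (Fin (k + 1)) (Fin (k + 1)) ℝ) (μ ν : ℝ) (b : Finset (Fin (k + 1))) :
    flat (μ • W + ν • udMat {0}) ⬝ᵥ udPt b = μ * (flat W ⬝ᵥ udPt b) + ν * (if (0 : Fin (k + 1)) ∈ b then 1 else 0) := by
  rw [flat_add₅, flat_smul₅, flat_smul₅, add_dotProduct, smul_dotProduct, smul_dotProduct, smul_eq_mul, smul_eq_mul]
  change μ * (flat W ⬝ᵥ udPt b) + ν * (udRow {0} ⬝ᵥ udPt b) = _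
  rw [udRow_singleton_dotProduct_udPt]

/-- ★ the singleton sub-pencil has the infinitesimal exact pencil at `{0}` (for every `B > 0`): given `W` and small `ε`, the row `({0}, W')`
with `W' = μ W + ν E₀₀`, `ν = 4 ε ‖W‖₁`, `μ = ε (1 + ν)` is the positive multiple `(1 + ν) · (E₀₀ + ε W)`, its entries are `≤ 6 ε ‖W‖₁ ≤ B`,
and its rhs `1 + h_COR(W')` is EXACT because the lift `ν E₀₀` pushes a COR-maximiser of `W'` into the face `x₀₀ = 1`. -/
theorem singletonTilted_pencil (B : ℕ → ℝ) (hB : ∀ n, 0 < B n) (k : ℕ) : Pencil (singletonTilted B) (k + 1) 0 := by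
  intro W δ hδ
  set S : ℝ := l1 (flat W) with hS
  have hS0 : 0 ≤ S := l1_nonneg _
  have hB' := hB (k + 1)
  have hε00 : 0 < min (1 / (4 * S + 4)) (B (k + 1) / (6 * S + 6)) := lt_min (by positivity) (by positivity)
  refine ⟨min δ (min (1 / (4 * S + 4)) (B (k + 1) / (6 * S + 6))), lt_min hδ hε00, min_le_left _ _, ?_⟩
  set ε : ℝ := min δ (min (1 / (4 * S + 4)) (B (k + 1) / (6 * S + 6))) with hεdef
  have hε : 0 < ε := lt_min hδ hε00
  have hεle : ε ≤ min (1 / (4 * S + 4)) (B (k + 1) / (6 * S + 6)) := min_le_right _ _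
  have hε1 : ε ≤ 1 / (4 * S + 4) := hεle.trans (min_le_left _ _)
  have hε2 : ε ≤ B (k + 1) / (6 * S + 6) := hεle.trans (min_le_right _ _)
  have hεS : 4 * ε * S ≤ 1 := by
    have h := (le_div_iff₀ (by positivity)).1 hε1
    nlinarith
  have hεB : 6 * ε * S + 6 * ε ≤ B (k + 1) := by
    have h := (le_div_iff₀ (by positivity)).1 hε2
    linarith
  set ν : ℝ := 4 * ε * S with hν
  set μ : ℝ := ε * (1 + ν) with hμ
  have hν0 : 0 ≤ ν := by positivity
  have hμ0 : 0 ≤ μ := by positivity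
  have hμle : μ ≤ 2 * ε := by rw [hμ]; nlinarith
  -- the bounded entries
  have hent : ∀ i j : Fin (k + 1), |(μ • W + ν • udMat {0} : Matrix (Fin (k + 1)) (Fin (k + 1)) ℝ) i j| ≤ B (k + 1) := by
    intro i j
    have h1 : |W i j| ≤ S := abs_apply_le_l1_flat W i j
    have h2 : |udMat ({0} : Finset (Fin (k + 1))) i j| ≤ 1 := abs_udMat_singleton_le 0 i j
    have e0 : (μ • W + ν • udMat {0} : Matrix (Fin (k + 1)) (Fin (k + 1)) ℝ) i j
        = μ * W i j + ν * udMat ({0} : Finset (Fin (k + 1))) i j := by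
      simp [Matrix.add_apply, Matrix.smul_apply, smul_eq_mul]
    rw [e0]
    have p1 : μ * |W i j| ≤ 2 * ε * S := mul_le_mul hμle h1 (abs_nonneg _) (by positivity)
    have p2 : ν * |udMat {0} i j| ≤ ν * 1 := mul_le_mul_of_nonneg_left h2 hν0
    calc |μ * W i j + ν * udMat ({0} : Finset (Fin (k + 1))) i j|
        ≤ |μ * W i j| + |ν * udMat ({0} : Finset (Fin (k + 1))) i j| := abs_add_le _ _
      _ = μ * |W i j| + ν * |udMat ({0} : Finset (Fin (k + 1))) i j| := by
          rw [abs_mul μ (W i j), abs_mul ν (udMat ({0} : Finset (Fin (k + 1))) i j), abs_of_nonneg hμ0,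
            abs_of_nonneg hν0]
      _ ≤ B (k + 1) := by linarith
  -- the row is the positive multiple `(1 + ν) • (E₀₀ + ε W)`
  have hρ : udRow {0} + flat (μ • W + ν • udMat {0}) = (1 + ν) • (udRow ({0} : Finset (Fin (k + 1))) + ε • flat W) := by
    have hud : flat (udMat ({0} : Finset (Fin (k + 1)))) = udRow {0} := rfl
    rw [flat_add₅, flat_smul₅, flat_smul₅, hud]
    ext p
    simp only [Pi.add_apply, Pi.smul_apply, smul_eq_mul, hμ]
    ring
  -- exactness of the rhs `1 + h_COR(W')`
  have hA : 1 + hCOR (μ • W + ν • udMat {0}) ≤ hCORv (udRow {0} + flat (μ • W + ν • udMat {0})) := by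
    obtain ⟨b₁, hb₁⟩ := exists_eq_hCOR (μ • W + ν • udMat {0})
    rw [← hb₁]
    by_cases h0 : (0 : Fin (k + 1)) ∈ b₁
    · have h := le_hCORv (udRow {0} + flat (μ • W + ν • udMat {0})) b₁
      rw [add_dotProduct, udRow_singleton_dotProduct_udPt, if_pos h0] at h
      exact h
    · have hle := le_hCORv (udRow {0} + flat (μ • W + ν • udMat {0})) (insert 0 b₁)
      rw [add_dotProduct, udRow_singleton_dotProduct_udPt, if_pos (Finset.mem_insert_self 0 b₁)] at hle
      have e1 := flat_tilt_dotProduct_udPt W μ ν b₁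
      have e2 := flat_tilt_dotProduct_udPt W μ ν (insert 0 b₁)
      rw [if_neg h0] at e1
      rw [if_pos (Finset.mem_insert_self 0 b₁)] at e2
      have f1 := (abs_le.1 (abs_dotProduct_udPt_le (flat W) b₁)).2
      have f2 := (abs_le.1 (abs_dotProduct_udPt_le (flat W) (insert 0 b₁))).1
      have p1 := mul_le_mul_of_nonneg_left f1 hμ0
      have p2 := mul_le_mul_of_nonneg_left f2 hμ0
      have p3 := mul_le_mul_of_nonneg_right hμle hS0
      have e3 : μ * -l1 (flat W) = -(μ * l1 (flat W)) := by ring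
      rw [← hS] at p1 p2 e3
      linarith
  refine ⟨⟨((0 : Fin (k + 1)), μ • W + ν • udMat {0}), hent⟩, 1 + ν, by positivity, hρ, ?_⟩
  show 1 + hCOR (μ • W + ν • udMat {0}) ≤ (1 + ν) * hCORv (udRow {0} + ε • flat W)
  refine hA.trans ?_
  rw [hρ]
  exact hCORv_smul_le (by positivity) _

/-- ★★★ **THE SINGLETON SUB-PENCIL OF `exactTilted` IS COR-VIRTUAL**: `(singletonTilted B).Law ↔ CorVirtualHardN` for every `B = B(n) > 0`. -/
theorem singletonTiltedLaw_iff (B : ℕ → ℝ) (hB : ∀ n, 0 < B n) : (singletonTilted B).Law ↔ CorVirtualHardN :=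
  law_iff_corVirtualHardN_of_pencil _ 0 fun k _ => singletonTilted_pencil B hB k

/-- ★★★ **C′ IS EQUIVALENT TO ITS OWN SINGLETON `B`-BOUNDED SUB-PENCIL**: `ExactPencilLaw ↔ (singletonTilted B).Law` (every `B > 0`).
(`←` is plain monotonicity, `exactPencilLaw_of_singletonTiltedLaw`: a smaller family has the stronger law; `→` — recovering the law of the
tiny sub-family from the law of all of `exactTilted` — goes THROUGH COR-VIRTUAL and is the content of the pencil collapse.) -/
theorem exactPencilLaw_iff_singletonTiltedLaw (B : ℕ → ℝ) (hB : ∀ n, 0 < B n) : ExactPencilLaw ↔ (singletonTilted B).Law :=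
  exactPencilLaw_iff_corVirtualHardN.trans (singletonTiltedLaw_iff B hB).symm

/-- sanity link with the tree's monotonicity: the singleton sub-pencil's law implies `ExactPencilLaw` directly (smaller family, stronger law). -/
theorem exactPencilLaw_of_singletonTiltedLaw (B : ℕ → ℝ) (h : (singletonTilted B).Law) : ExactPencilLaw :=
  RowFamily.Law.mono (singletonTiltedEmb B) h

end Summit.ValiantsHypothesis.ValiantsHypothesis.Cruxes.NNDivisionHard.PencilCollapse41
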